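import Summits.Ventures.WeilGRH.GL2BaseRungTransfer
import Summits.Ventures.WeilGRH.OnePrimeTransfer
import Summits.RiemannHypothesis.RiemannHypothesis.Theorems.GroundBartaEvenWinsBeyondArchPositivity8046
import HarnessLib

/-!
# GL₂ windows with finitely many primes inside, by transfer from the `ζ` ladder:
# `WeilPositivityOnGL2 k N Λf (log 2)` (`N ≥ 3·10⁶`) and `WeilPositivityOnGL2 k N Λf (4023/5000)` (`N ≥ 2·10⁸`)

Cell `rh-explicit`, P-1 «A2-ext» (producer seat rh-explicit-moll-step0-2), sequel of `GL2BaseRungTransfer.lean`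
(base rung, `N ≥ 17`) and `GL2OnePrimeTransfer.lean` (`(log 3)/2`, `N ≥ 5000`): the GENERIC transfer of a `ζ`
rung `WeilPositivityOn a` (kernel-checked up to the ladder's frontier `a = 4023/5000`,
`EvenWinsBeyondArch.weilPositivityOn_of_le_8046`) to the typed GL₂ functional `weilQuadraticGL2 k N Λf`
(weil-grh-1) under the Ramanujan-type bound `‖Λf n‖ ≤ 2Λ(n)` (`|b(p^m)| = |α_p^m + ᾱ_p^m| ≤ 2`):
with `M` such that `2a ≤ log M` only `n < M` enter, and
`Re Q_f(g) ≥ ‖g‖₂² (log N − 4(sinh a + a) − 8 Σ_{n<M} Λ(n)/√n)`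
(density comparison `arch_integral_quarter_add_le`, Plancherel, polar bound `weilPolar_re_le`,
`|h(± log n)| ≤ ‖g‖₂²` for `h = g ⋆ g̃`, and `|2Λ(n) − Λf(n)| ≤ 4Λ(n)`).
RESULTS: `weilPositivityOnGL2_of_zeta_rung` (generic); `weilPositivityOnGL2_log_two_of_ge` (`a = log 2`,
`M = 4`: `3 + 4 log 2 + 8(log 2/√2 + log 3/√3) = 14.768 ≤ 15 ≤ log N`, e.g. `N ≥ 3.3·10⁶`);
`weilPositivityOnGL2_8046_of_ge` (`a = 4023/5000`, `M = 5`: `… + 4 log 2 = 18.57 ≤ 19 ≤ log N`, e.g. `N ≥ 1.8·10⁸`).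
So the kernel-checked GL₂ transfer ladder reads `(log 2)/2: N ≥ 17 · (log 3)/2: N ≥ 5000 · log 2: N ≥ 3.3·10⁶ ·
4023/5000: N ≥ 1.8·10⁸` — the price of transferring instead of certifying grows like `e^{8 Σ Λ(n)/√n}`; the
producer's / weil-4's certificates give the true thresholds (`7`, `31`, `≈ 11–23` by `(a₂, a₃)`). Honest framing
as in the sibling files: statements about the typed functional with a coefficient PARAMETER `Λf`.
-/

noncomputable section

open Complex Filter Set MeasureTheory Finset
open scoped Real Topology ComplexConjugate ArithmeticFunction.vonMangoldt

namespace Summit.Ventures.WeilGRH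

open Literature.NumberTheory.LFunctions Literature.Analysis.SpecialFunctions.Complex
  Summit.RiemannHypothesis.RiemannHypothesis.Theorems.EvenWinsBeyondArch

variable {g : ℝ → ℂ}

/-! ## Finite prime sums on a window `2a ≤ log M` -/

/-- If `h` is continuous with `tsupport h ⊆ [-b, b]` and `b ≤ log M` (`M ≥ 1`), then `h(± log n) = 0` for
every `n ≥ M`. [folklore] -/
theorem apply_log_eq_zero_of_le {h : ℝ → ℂ} (hh : Continuous h) {b : ℝ} (hs : tsupport h ⊆ Icc (-b) b)
    {M : ℕ} (hM1 : 1 ≤ M) (hM : b ≤ Real.log M) {n : ℕ} (hn : M ≤ n) :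
    h (Real.log n) = 0 ∧ h (-Real.log n) = 0 := by
  have hsupp := support_subset_Ioo_of_tsupport_subset_Icc hh hs
  have hlog : Real.log M ≤ Real.log n :=
    Real.log_le_log (by exact_mod_cast hM1) (by exact_mod_cast hn)
  constructor
  · by_contra hne; have := (hsupp hne).2; linarith
  · by_contra hne; have := (hsupp hne).1; linarith

/-- The prime term of the holomorphic datum on a window inside `[-log M, log M]` is the finite sum over
`n < M`. [folklore] -/
theorem primeTerm_holomorphic_eq_sum {k : ℕ} {Λf : ℕ → ℂ} {h : ℝ → ℂ} (hh : Continuous h) {b : ℝ}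
    (hs : tsupport h ⊆ Icc (-b) b) {M : ℕ} (hM1 : 1 ≤ M) (hM : b ≤ Real.log M) :
    (weilLDatumHolomorphic k 1 Λf).primeTerm h =
      ∑ n ∈ range M, (Λf n * h (Real.log n) + conj (Λf n) * h (-Real.log n)) / (Real.sqrt n : ℂ) := by
  unfold WeilLDatum.primeTerm
  have hv : (weilLDatumHolomorphic k 1 Λf).vonMangoldt = Λf := rfl
  rw [hv]
  refine tsum_eq_sum fun n hn ↦ ?_
  have hMn : M ≤ n := by simpa using hn
  obtain ⟨e1, e2⟩ := apply_log_eq_zero_of_le hh hs hM1 hM hMn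
  simp [e1, e2]

/-- The `ζ` prime term on the same window is the finite sum `Σ_{n<M} Λ(n) n^{-1/2}(h(log n) + h(−log n))`.
[folklore] -/
theorem weilPrimeTerm_eq_sum {h : ℝ → ℂ} (hh : Continuous h) {b : ℝ} (hs : tsupport h ⊆ Icc (-b) b)
    {M : ℕ} (hM1 : 1 ≤ M) (hM : b ≤ Real.log M) :
    weilPrimeTerm h =
      ∑ n ∈ range M, ((Λ n : ℝ) : ℂ) / (Real.sqrt n : ℂ) * (h (Real.log n) + h (-Real.log n)) := by
  unfold weilPrimeTerm
  refine tsum_eq_sum fun n hn ↦ ?_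
  have hMn : M ≤ n := by simpa using hn
  obtain ⟨e1, e2⟩ := apply_log_eq_zero_of_le hh hs hM1 hM hMn
  simp [e1, e2]

/-- **Closed form with finitely many primes**: `Λf 0 = Λf 1 = 0`, `supp g ⊆ [-a, a]`, `2a ≤ log M`:
`Re Q_f(g) = ‖g‖₂²(log N − 2 log 2π) + (1/π)∫|ĝ(½+it)|² Re ψ(k/2+it) dt − Re Σ_{n<M} (Λf(n) h(log n) + conj Λf(n) h(−log n))/√n`.
[cite: IwaniecKowalski2004, §5.5 Thm 5.12 (5.45)] -/
theorem re_weilQuadraticGL2_eq_of_le_log {k N : ℕ} {Λf : ℕ → ℂ} (hg : IsWeilTest g) {a : ℝ}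
    (hsupp : tsupport g ⊆ Icc (-a) a) {M : ℕ} (hM1 : 1 ≤ M) (hM : 2 * a ≤ Real.log M) :
    (weilQuadraticGL2 k N Λf g).re =
      (∫ t : ℝ, ‖g t‖ ^ 2) * (Real.log N - 2 * Real.log (2 * π)) +
        1 / π * (∫ t : ℝ, ‖weilMellin g (1 / 2 + t * I)‖ ^ 2 * (digamma ((k : ℂ) / 2 + t * I)).re) -
        (∑ n ∈ range M, (Λf n * weilConv g (weilReflect g) (Real.log n) +
          conj (Λf n) * weilConv g (weilReflect g) (-Real.log n)) / (Real.sqrt n : ℂ)).re := by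
  have hk : IsWeilTest (weilConv g (weilReflect g)) := hg.weilConv hg.weilReflect
  have hsub : tsupport (weilConv g (weilReflect g)) ⊆ Icc (-(2 * a)) (2 * a) :=
    tsupport_weilConv_weilReflect_subset hg.2 hsupp
  rw [weilQuadraticGL2, primeTerm_holomorphic_eq_sum hk.1.continuous hsub hM1 hM,
    weilConv_weilReflect_apply_zero, sub_re]
  congr 1
  have hA : (∫ t : ℝ, weilMellin (weilConv g (weilReflect g)) (1 / 2 + t * I) *
      ((digamma ((k : ℂ) / 2 + t * I)).re : ℂ)) =
      ((∫ t : ℝ, ‖weilMellin g (1 / 2 + t * I)‖ ^ 2 * (digamma ((k : ℂ) / 2 + t * I)).re : ℝ) : ℂ) := by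
    rw [← integral_complex_ofReal]
    congr 1 with t
    rw [weilMellin_weilConv_weilReflect_half hg]
    push_cast; ring
  rw [hA, show ((1 / π : ℂ)) = ((1 / π : ℝ) : ℂ) by push_cast; ring]
  simp only [← Complex.ofReal_mul, ← Complex.ofReal_add, Complex.ofReal_re]
  ring

/-! ## The generic transfer -/

/-- **GL₂ transfer of a `ζ` rung through finitely many primes.** For even `k ≥ 2`, coefficients with
`‖Λf n‖ ≤ 2Λ(n)` for all `n`, a window with `2a ≤ log M` on which Weil positivity for `ζ` holds, and
`4(sinh a + a) + 8 Σ_{n<M} Λ(n)/√n ≤ log N`: `WeilPositivityOnGL2 k N Λf a`.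
[cite: IwaniecKowalski2004, §5.5 Thm 5.12 (5.45); Yoshida1992, Thm 1] -/
theorem weilPositivityOnGL2_of_zeta_rung {k N : ℕ} {Λf : ℕ → ℂ} (hk : Even k) (hk2 : 2 ≤ k)
    (hΛ : ∀ n, ‖Λf n‖ ≤ 2 * Λ n) {a : ℝ} {M : ℕ} (hM1 : 1 ≤ M) (hM : 2 * a ≤ Real.log M)
    (hζ : WeilPositivityOn a)
    (hN : 4 * (Real.sinh a + a) + 8 * ∑ n ∈ range M, (Λ n : ℝ) / Real.sqrt n ≤ Real.log N) :
    WeilPositivityOnGL2 k N Λf a := by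
  intro g hg hsupp
  obtain ⟨m, hkm⟩ := hk
  have hm : 1 ≤ m := by omega
  -- the GL₂ side
  have hQ := re_weilQuadraticGL2_eq_of_le_log (k := k) (N := N) (Λf := Λf) hg hsupp hM1 hM
  have hk2c : ∀ t : ℝ, ((k : ℂ) / 2 + t * I) = ((m : ℂ) + t * I) := by
    intro t; rw [hkm]; push_cast; ring
  simp_rw [hk2c] at hQ
  set h := weilConv g (weilReflect g) with hh
  have hht : IsWeilTest h := hg.weilConv hg.weilReflect
  have hhs : tsupport h ⊆ Icc (-(2 * a)) (2 * a) := tsupport_weilConv_weilReflect_subset hg.2 hsupp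
  set Ng : ℝ := ∫ t : ℝ, ‖g t‖ ^ 2 with hNg
  set A0 : ℝ := ∫ t : ℝ, ‖weilMellin g (1 / 2 + t * I)‖ ^ 2 *
      (digamma (1 / 4 + t / 2 * I)).re with hA0
  set Am : ℝ := ∫ t : ℝ, ‖weilMellin g (1 / 2 + t * I)‖ ^ 2 *
      (digamma ((m : ℂ) + t * I)).re with hAm
  set P : ℝ := 2 * (weilMellin g 0 * conj (weilMellin g 1)).re with hP
  set Df : ℂ := ∑ n ∈ range M, (Λf n * h (Real.log n) + conj (Λf n) * h (-Real.log n)) /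
    (Real.sqrt n : ℂ) with hDf
  set Dz : ℂ := ∑ n ∈ range M, ((Λ n : ℝ) : ℂ) / (Real.sqrt n : ℂ) * (h (Real.log n) + h (-Real.log n))
    with hDz
  -- the `ζ` side
  have hζg : 0 ≤ (weilQuadratic g).re := hζ g hg hsupp
  have hZ : weilQuadratic g = weilPolarTerm h - weilPrimeTerm h + weilArchTerm h := rfl
  have hζre : (weilQuadratic g).re = P - Dz.re + (1 / (2 * π) * A0 - Ng * Real.log π) := by
    rw [hZ, weilArchTerm, hh, weilPolarTerm_weilConv_weilReflect hg,
      weilPrimeTerm_eq_sum hht.1.continuous hhs hM1 hM, weilArchIntegral_weilConv_weilReflect hg,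
      weilConv_weilReflect_apply_zero,
      show ((1 / (2 * π) : ℂ)) = ((1 / (2 * π) : ℝ) : ℂ) by push_cast; ring]
    simp only [sub_re, add_re, Complex.ofReal_re, Complex.re_mul_ofReal, hP, hDz, hNg, hA0]
  -- the correction `E = 2 D_ζ − D_f` and its bound `‖E‖ ≤ 8 Ng Σ Λ(n)/√n`
  have hNg0 : 0 ≤ Ng := integral_nonneg fun t ↦ by positivity
  set S : ℝ := ∑ n ∈ range M, (Λ n : ℝ) / Real.sqrt n with hS
  have hE : -(8 * S * Ng) ≤ (2 * Dz - Df).re := by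
    have hterm : ∀ n ∈ range M,
        ‖2 * (((Λ n : ℝ) : ℂ) / (Real.sqrt n : ℂ) * (h (Real.log n) + h (-Real.log n))) -
          (Λf n * h (Real.log n) + conj (Λf n) * h (-Real.log n)) / (Real.sqrt n : ℂ)‖ ≤
          8 * ((Λ n : ℝ) / Real.sqrt n) * Ng := by
      intro n _
      have hu : ‖h (Real.log n)‖ ≤ Ng := norm_weilConv_weilReflect_le hg _
      have hv : ‖h (-Real.log n)‖ ≤ Ng := norm_weilConv_weilReflect_le hg _
      have hΛ0 : 0 ≤ (Λ n : ℝ) := ArithmeticFunction.vonMangoldt_nonneg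
      have hc1 : ‖2 * ((Λ n : ℝ) : ℂ) - Λf n‖ ≤ 4 * Λ n := by
        calc ‖2 * ((Λ n : ℝ) : ℂ) - Λf n‖ ≤ ‖2 * ((Λ n : ℝ) : ℂ)‖ + ‖Λf n‖ := norm_sub_le _ _
          _ ≤ 2 * Λ n + 2 * Λ n := by
              refine add_le_add (le_of_eq ?_) (hΛ n)
              rw [show (2 : ℂ) * ((Λ n : ℝ) : ℂ) = ((2 * Λ n : ℝ) : ℂ) by push_cast; ring,
                Complex.norm_real, Real.norm_eq_abs, abs_of_nonneg (by positivity)]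
          _ = 4 * Λ n := by ring
      have hc2 : ‖2 * ((Λ n : ℝ) : ℂ) - conj (Λf n)‖ ≤ 4 * Λ n := by
        rw [show (2 : ℂ) * ((Λ n : ℝ) : ℂ) - conj (Λf n) = conj (2 * ((Λ n : ℝ) : ℂ) - Λf n) by
          simp only [map_sub, map_mul, map_ofNat, Complex.conj_ofReal], Complex.norm_conj]
        exact hc1
      rcases Nat.eq_zero_or_pos n with hn0 | hn0
      · subst hn0; simp
      have hs0 : (0 : ℝ) < Real.sqrt n := Real.sqrt_pos.2 (by exact_mod_cast hn0)
      have hden : ‖(Real.sqrt n : ℂ)‖ = Real.sqrt n := by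
        rw [Complex.norm_real, Real.norm_eq_abs, abs_of_pos hs0]
      have hrw : 2 * (((Λ n : ℝ) : ℂ) / (Real.sqrt n : ℂ) * (h (Real.log n) + h (-Real.log n))) -
          (Λf n * h (Real.log n) + conj (Λf n) * h (-Real.log n)) / (Real.sqrt n : ℂ) =
          ((2 * ((Λ n : ℝ) : ℂ) - Λf n) * h (Real.log n) +
            (2 * ((Λ n : ℝ) : ℂ) - conj (Λf n)) * h (-Real.log n)) / (Real.sqrt n : ℂ) := by
        have : (Real.sqrt n : ℂ) ≠ 0 := Complex.ofReal_ne_zero.2 hs0.ne'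
        field_simp
        ring
      rw [hrw, norm_div, hden, div_le_iff₀ hs0]
      calc ‖(2 * ((Λ n : ℝ) : ℂ) - Λf n) * h (Real.log n) +
            (2 * ((Λ n : ℝ) : ℂ) - conj (Λf n)) * h (-Real.log n)‖
          ≤ 4 * Λ n * Ng + 4 * Λ n * Ng := by
            refine (norm_add_le _ _).trans (add_le_add ?_ ?_)
            · rw [norm_mul]; exact mul_le_mul hc1 hu (norm_nonneg _) (by positivity)
            · rw [norm_mul]; exact mul_le_mul hc2 hv (norm_nonneg _) (by positivity)
        _ = 8 * ((Λ n : ℝ) / Real.sqrt n) * Ng * Real.sqrt n := by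
            field_simp
            ring
    have hsum : ‖2 * Dz - Df‖ ≤ 8 * S * Ng := by
      rw [hDz, hDf, hS, Finset.mul_sum, ← Finset.sum_sub_distrib, Finset.mul_sum, Finset.sum_mul]
      refine (norm_sum_le _ _).trans (Finset.sum_le_sum fun n hn ↦ ?_)
      have := hterm n hn
      linarith
    have := (abs_le.1 (Complex.abs_re_le_norm (2 * Dz - Df))).1
    linarith
  have hEre : (2 * Dz - Df).re = 2 * Dz.re - Df.re := by
    simp [Complex.sub_re, Complex.mul_re]
  -- the density comparison and the polar bound
  have hA : A0 + 2 * π * Real.log 2 * Ng ≤ Am := arch_integral_quarter_add_le hg hm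
  have hPle : P ≤ 2 * (Real.sinh a + a) * Ng := weilPolar_re_le hg hsupp
  have hπ : 0 < π := Real.pi_pos
  have hlog2π : Real.log (2 * π) = Real.log 2 + Real.log π := Real.log_mul (by norm_num) hπ.ne'
  rw [hQ, hlog2π]
  have hq1 : 1 / π * Am ≥ 1 / π * (A0 + 2 * π * Real.log 2 * Ng) :=
    mul_le_mul_of_nonneg_left hA (by positivity)
  have hq2 : 1 / π * (A0 + 2 * π * Real.log 2 * Ng) = 2 * (1 / (2 * π) * A0) + 2 * Real.log 2 * Ng := by
    field_simp
  rw [hζre] at hζg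
  rw [hEre] at hE
  nlinarith [mul_le_mul_of_nonneg_right hN hNg0]

/-! ## Instances at the `ζ` ladder's rungs `log 2` (two primes) and `4023/5000` (the frontier; `n = 2, 3, 4`) -/

/-- `Σ_{n<4} Λ(n)/√n = log 2/√2 + log 3/√3` and `Σ_{n<5} Λ(n)/√n = log 2/√2 + log 3/√3 + log 2/2`
(`Λ(4) = log 2`, `√4 = 2`). [folklore] -/
theorem sum_vonMangoldt_div_sqrt_range_five :
    ∑ n ∈ range 4, (Λ n : ℝ) / Real.sqrt n = Real.log 2 / Real.sqrt 2 + Real.log 3 / Real.sqrt 3 ∧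
    ∑ n ∈ range 5, (Λ n : ℝ) / Real.sqrt n =
      Real.log 2 / Real.sqrt 2 + Real.log 3 / Real.sqrt 3 + Real.log 2 / 2 := by
  have h2 : (Λ 2 : ℝ) = Real.log 2 := by
    rw [ArithmeticFunction.vonMangoldt_apply_prime Nat.prime_two]; norm_num
  have h3 : (Λ 3 : ℝ) = Real.log 3 := by
    rw [ArithmeticFunction.vonMangoldt_apply_prime Nat.prime_three]; norm_num
  have h4 : (Λ 4 : ℝ) = Real.log 2 := by
    rw [show (4 : ℕ) = 2 ^ 2 by norm_num, ArithmeticFunction.vonMangoldt_apply_pow (by norm_num),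
      ArithmeticFunction.vonMangoldt_apply_prime Nat.prime_two]
    norm_num
  have hs4 : Real.sqrt (4 : ℕ) = 2 := by
    rw [show ((4 : ℕ) : ℝ) = 2 ^ 2 by norm_num, Real.sqrt_sq (by norm_num)]
  have e4 : ∑ n ∈ range 4, (Λ n : ℝ) / Real.sqrt n = Real.log 2 / Real.sqrt 2 + Real.log 3 / Real.sqrt 3 := by
    simp [Finset.sum_range_succ, h2, h3, ArithmeticFunction.vonMangoldt_apply_one]
  refine ⟨e4, ?_⟩
  rw [Finset.sum_range_succ, e4, h4, hs4]

/-- Numerics: `8 (log 2/√2 + log 3/√3) < 9.003` (`1/√2 < 0.70711`, `1/√3 < 0.5774`, `log 2 < 0.6931471808`,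
`log 3 < 1.1` from `3 < Σ_{i<6} 1.1^i/i! ≤ e^{1.1}`). [folklore] -/
theorem eight_mul_sum_two_primes_lt :
    8 * (Real.log 2 / Real.sqrt 2 + Real.log 3 / Real.sqrt 3) < 9.003 := by
  have hs2 : (1.41421 : ℝ) < Real.sqrt 2 := by
    rw [show (1.41421 : ℝ) = Real.sqrt (1.41421 ^ 2) by rw [Real.sqrt_sq (by norm_num)]]
    exact Real.sqrt_lt_sqrt (by norm_num) (by norm_num)
  have hs3 : (1.73205 : ℝ) < Real.sqrt 3 := by
    rw [show (1.73205 : ℝ) = Real.sqrt (1.73205 ^ 2) by rw [Real.sqrt_sq (by norm_num)]]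
    exact Real.sqrt_lt_sqrt (by norm_num) (by norm_num)
  have hl2 : Real.log 2 < 0.6931471808 := Real.log_two_lt_d9
  have hl20 : 0 < Real.log 2 := Real.log_pos (by norm_num)
  have hl3 : Real.log 3 < 1.1 := by
    rw [Real.log_lt_iff_lt_exp (by norm_num)]
    have h := Real.sum_le_exp_of_nonneg (show (0 : ℝ) ≤ 1.1 by norm_num) 6
    have hs : (3 : ℝ) < ∑ i ∈ range 6, (1.1 : ℝ) ^ i / (i.factorial : ℝ) := by
      norm_num [Finset.sum_range_succ, Nat.factorial]
    linarith
  have hl30 : 0 < Real.log 3 := Real.log_pos (by norm_num)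
  have hd2 : Real.log 2 / Real.sqrt 2 < 0.6931471808 / 1.41421 := by
    rw [div_lt_div_iff₀ (by positivity) (by norm_num)]
    nlinarith
  have hd3 : Real.log 3 / Real.sqrt 3 < 1.1 / 1.73205 := by
    rw [div_lt_div_iff₀ (by positivity) (by norm_num)]
    nlinarith
  have : (0.6931471808 : ℝ) / 1.41421 + 1.1 / 1.73205 < 9.003 / 8 := by norm_num
  linarith

/-- **The rung `log 2` (primes `2, 3` inside) for GL₂ by transfer**: even `k ≥ 2`, `‖Λf n‖ ≤ 2Λ(n)`,
`15 ≤ log N` (e.g. `N ≥ 3 300 000`) ⟹ `WeilPositivityOnGL2 k N Λf (log 2)`; from the kernel-checked `ζ`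
rung `WeilPositivityOn (log 2)` (`weilPositivityOn_of_le_8046`), `sinh(log 2) = 3/4`.
[cite: IwaniecKowalski2004, §5.5 Thm 5.12 (5.45); Yoshida1992, Thm 1] -/
theorem weilPositivityOnGL2_log_two_of_ge {k N : ℕ} {Λf : ℕ → ℂ} (hk : Even k) (hk2 : 2 ≤ k)
    (hΛ : ∀ n, ‖Λf n‖ ≤ 2 * Λ n) (hN : 15 ≤ Real.log N) :
    WeilPositivityOnGL2 k N Λf (Real.log 2) := by
  have hζ : WeilPositivityOn (Real.log 2) :=
    weilPositivityOn_of_le_8046 (by linarith [Real.log_two_lt_d9])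
  have hM : 2 * Real.log 2 ≤ Real.log (4 : ℕ) := by
    rw [show ((4 : ℕ) : ℝ) = 2 ^ 2 by norm_num, Real.log_pow]; norm_num
  refine weilPositivityOnGL2_of_zeta_rung hk hk2 hΛ (M := 4) (by norm_num) hM hζ ?_
  rw [sum_vonMangoldt_div_sqrt_range_five.1]
  have hsinh : Real.sinh (Real.log 2) = 3 / 4 := by
    rw [Real.sinh_eq, Real.exp_log (by norm_num), Real.exp_neg, Real.exp_log (by norm_num)]; norm_num
  rw [hsinh]
  have h8 := eight_mul_sum_two_primes_lt
  linarith [Real.log_two_lt_d9]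

/-- `log N ≥ 15` for `N ≥ 3 300 000` (`e^{15} < 2.7182818286^{15} < 3 300 000`). [folklore] -/
theorem fifteen_le_log_of_ge {N : ℕ} (hN : 3300000 ≤ N) : 15 ≤ Real.log N := by
  have he : Real.exp 1 < 2.7182818286 := Real.exp_one_lt_d9
  have h15 : Real.exp 15 < 3300000 := by
    have h' : Real.exp 15 = Real.exp 1 ^ 15 := by rw [← Real.exp_nat_mul]; norm_num
    rw [h']
    have hp : Real.exp 1 ^ 15 < (2.7182818286 : ℝ) ^ 15 :=
      pow_lt_pow_left₀ he (Real.exp_pos 1).le (by norm_num)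
    have hn : (2.7182818286 : ℝ) ^ 15 < 3300000 := by norm_num
    linarith
  have hlog : (15 : ℝ) < Real.log 3300000 := by
    rw [Real.lt_log_iff_exp_lt (by norm_num)]; exact h15
  exact hlog.le.trans (Real.log_le_log (by norm_num) (by exact_mod_cast hN))

/-- **The frontier rung `a = 4023/5000` (`n = 2, 3, 4` inside) for GL₂ by transfer**: even `k ≥ 2`,
`‖Λf n‖ ≤ 2Λ(n)`, `19 ≤ log N` (e.g. `N ≥ 1.8·10⁸`) ⟹ `WeilPositivityOnGL2 k N Λf (4023/5000)`; from the
`ζ` ladder's frontier `EvenWinsBeyondArch.weilPositivityOn_8046` (RH-free, kernel-checked), with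
`2·(4023/5000) ≤ log 5` (`e^{4023/5000} ≤ 2.2359`, `2.2359² < 5`) and `sinh(4023/5000) < 0.9`.
[cite: IwaniecKowalski2004, §5.5 Thm 5.12 (5.45); Yoshida1992, Thm 1] -/
theorem weilPositivityOnGL2_8046_of_ge {k N : ℕ} {Λf : ℕ → ℂ} (hk : Even k) (hk2 : 2 ≤ k)
    (hΛ : ∀ n, ‖Λf n‖ ≤ 2 * Λ n) (hN : 19 ≤ Real.log N) :
    WeilPositivityOnGL2 k N Λf (4023 / 5000) := by
  -- `e^{4023/5000} ≤ 2.2359`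
  have hexp : Real.exp (4023 / 5000) ≤ 2.2359 := by
    have h := Real.exp_bound' (x := (4023 / 5000 : ℝ)) (by norm_num) (by norm_num) (n := 10) (by norm_num)
    have hs : (∑ m ∈ range 10, (4023 / 5000 : ℝ) ^ m / (m.factorial : ℝ)) +
        (4023 / 5000 : ℝ) ^ 10 * (10 + 1) / ((10 : ℕ).factorial * 10) ≤ 2.2359 := by
      norm_num [Finset.sum_range_succ, Nat.factorial]
    exact h.trans (by exact_mod_cast hs)
  have hexp0 : 0 < Real.exp (4023 / 5000) := Real.exp_pos _
  have hM : 2 * (4023 / 5000 : ℝ) ≤ Real.log (5 : ℕ) := by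
    rw [show 2 * (4023 / 5000 : ℝ) = (4023 / 2500 : ℝ) by norm_num,
      Real.le_log_iff_exp_le (by norm_num)]
    have hsq : Real.exp (4023 / 2500) = Real.exp (4023 / 5000) ^ 2 := by
      rw [← Real.exp_nat_mul]; norm_num
    rw [hsq]
    push_cast
    nlinarith
  have hsinh : Real.sinh (4023 / 5000 : ℝ) < 0.9 := by
    rw [Real.sinh_eq]
    have hinv : 0.44 < Real.exp (-(4023 / 5000 : ℝ)) := by
      rw [Real.exp_neg, lt_inv_comm₀ (by norm_num) hexp0]
      linarith
    linarith
  refine weilPositivityOnGL2_of_zeta_rung hk hk2 hΛ (M := 5) (by norm_num) hM weilPositivityOn_8046 ?_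
  rw [sum_vonMangoldt_div_sqrt_range_five.2]
  have h8 := eight_mul_sum_two_primes_lt
  nlinarith [Real.log_two_lt_d9]

/-- `log N ≥ 19` for `N ≥ 180 000 000` (`e^{19} < 2.7182818286^{19} < 1.8·10⁸`). [folklore] -/
theorem nineteen_le_log_of_ge {N : ℕ} (hN : 180000000 ≤ N) : 19 ≤ Real.log N := by
  have he : Real.exp 1 < 2.7182818286 := Real.exp_one_lt_d9
  have h19 : Real.exp 19 < 180000000 := by
    have h' : Real.exp 19 = Real.exp 1 ^ 19 := by rw [← Real.exp_nat_mul]; norm_num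
    rw [h']
    have hp : Real.exp 1 ^ 19 < (2.7182818286 : ℝ) ^ 19 :=
      pow_lt_pow_left₀ he (Real.exp_pos 1).le (by norm_num)
    have hn : (2.7182818286 : ℝ) ^ 19 < 180000000 := by norm_num
    linarith
  have hlog : (19 : ℝ) < Real.log 180000000 := by
    rw [Real.lt_log_iff_exp_lt (by norm_num)]; exact h19
  exact hlog.le.trans (Real.log_le_log (by norm_num) (by exact_mod_cast hN))

/-- **Rung `log 2` for GL₂, integer form**: even `k ≥ 2`, `‖Λf n‖ ≤ 2Λ(n)`, `N ≥ 3 300 000` ⟹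
`WeilPositivityOnGL2 k N Λf (log 2)`. [cite: IwaniecKowalski2004, §5.5 Thm 5.12 (5.45); Yoshida1992, Thm 1] -/
theorem weilPositivityOnGL2_log_two_of_ge_3300000 {k N : ℕ} {Λf : ℕ → ℂ} (hk : Even k) (hk2 : 2 ≤ k)
    (hΛ : ∀ n, ‖Λf n‖ ≤ 2 * Λ n) (hN : 3300000 ≤ N) : WeilPositivityOnGL2 k N Λf (Real.log 2) :=
  weilPositivityOnGL2_log_two_of_ge hk hk2 hΛ (fifteen_le_log_of_ge hN)

/-- **Frontier rung `4023/5000` for GL₂, integer form**: even `k ≥ 2`, `‖Λf n‖ ≤ 2Λ(n)`, `N ≥ 180 000 000` ⟹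
`WeilPositivityOnGL2 k N Λf (4023/5000)`. [cite: IwaniecKowalski2004, §5.5 Thm 5.12 (5.45); Yoshida1992, Thm 1] -/
theorem weilPositivityOnGL2_8046_of_ge_180000000 {k N : ℕ} {Λf : ℕ → ℂ} (hk : Even k) (hk2 : 2 ≤ k)
    (hΛ : ∀ n, ‖Λf n‖ ≤ 2 * Λ n) (hN : 180000000 ≤ N) : WeilPositivityOnGL2 k N Λf (4023 / 5000) :=
  weilPositivityOnGL2_8046_of_ge hk hk2 hΛ (nineteen_le_log_of_ge hN)

end Summit.Ventures.WeilGRH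

end
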